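import Summits.ABC.IUTFork.Joshi.LogLinkInsertedIso
import Summits.ABC.IUTFork.Joshi.LogLinkConfluentColumnModel
import HarnessLib

/-!
# [J-IIp] §10.13 read LITERALLY: where ϕ on `|Y|` is induced by a (surjective) ring endomorphism φ of `B`, the Frobenius
# transport EXISTS — so the (R-fix) horn of Thm. 10.15.1 (3) has NO realisation over [FF18]'s standing structure
# (located sentence in kernel; no side taken)

Proof-only companion (abc-iut cell, block E «type Joshi's construction, test vs S», rung LADDER-ABC:A2.E; seat abc-iut-E-t7,
gen 4 — AUTHORS-FIRST derivable item on this seat's own `Joshi/LogLinkFrobeniusTransport.lean` p430819 and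
`Joshi/LogLinkInsertedIso.lean` p436476; it puts in kernel the READING NOTE left by this seat's owner-side audit of E-t52's
`Joshi/LogLinkConfluentColumnModel.lean` p439129, STATUS 2026-08-26T11:12:00Z INFO-2). Source: K. Joshi, arXiv:2303.01662v3
(`paper:arxiv-2303.01662`; bib `Joshi2023ATS2Local`; unrefereed — TYPED AS A CANDIDATE), §10.5 / §10.13–§10.15, render
`HOME/lit/renders/Joshi-arxiv-2303.01662/p0031.txt`, `p0033.txt` («p.N l.M»). TAKES NO SIDE on [IUTchIII] Cor. 3.12, on Joshi's
claims, or on Mochizuki's reports on them; typed ≠ proved; a located sentence is NOT a verdict on any author. Object-side file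
(E-PLAN R14: no `Cor312*`/`Thm311*` import); no FACT-LIST row consumed; 0 `def`/`structure`/`instance`; nothing asserted.

PRINT. §10.13 (p.33 l.1–12): along the fibre over `x_can`, «`ϕ(𝔪_{y_{n−1}}) = 𝔪_{ϕ(y_{n−1})} = 𝔪_{y_n}` … `ϕ([a] − p) = [a^p] − p`
generates the prime ideal corresponding to `ϕ(y_{n−1}) = y_n`» — an equation of IDEALS of `B`: the image of `𝔪_y` under the
Frobenius `φ` of `B` is `𝔪_{ϕ(y)}`; print obtains the point `ϕ(y)` exactly this way (l.8–10: «`ϕ([a] − p) = [ϕ(a)] − p = [a^p] − p`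
generates the prime ideal corresponding to `ϕ(y_{n−1}) = y_n`»). That `φ` is a ring AUTOMORPHISM of `B = B_F` (the Witt-vector
Frobenius of the perfect ring `𝒪_F` is bijective, [FF18]) enters below only as the HYPOTHESIS «`φ` onto»; nothing of [FF18] is
asserted. §10.5 (p.31 l.40–45): «canonical surjection `η_{K_y} : B → K_y`».
Thm. 10.15.1 (3) (p.33 l.66–68) and its proof «`τ(1) = p`» (l.75–77) — see p430819's module docstring.

WHAT THE LINEAGE RECORDED. p430819 typed §10.13 at a point `y` as the HYPOTHESIS structure `FrobeniusTransport D y` whose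
field `ker_eq` is the KERNEL form `ker (η_{ϕ(y)} ∘ φ) = ker η_y` (i.e. `φ⁻¹(𝔪_{ϕ(y)}) = 𝔪_y`), and showed: transport ⇒ (3) fails in
E-t3's middle-row form; p436476: transport ⇒ (3) fails in the common-target form for EVERY identification with `ℂ_p`, and the
reading (R-fix) (`LogsCoincide`) under which print's proof goes through is INCONSISTENT with a transport (given «log hits `1`»,
`p ≠ 1`). E-t52's p439129 then exhibited ONE structure over the whole signature carrying BOTH horns at consecutive column points,
the (R-fix) horn sitting exactly where the transport is empty (`ConfluentModel.no_transport_zero`) — realised by a Frobenius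
`φ = (· ∘ σ′)` with `σ′` confluent.

WHAT THIS FILE ADDS (kernel, over explicit hypotheses; all `theorem`s).
* §1 `ker_comp_eq_of_map_ker_eq`: §10.13 read LITERALLY — `Ideal.map φ (ker η_y) = ker η_{ϕ(y)}` for a ring endomorphism `φ`
  of `B` — IMPLIES p430819's kernel form as soon as `η_y` is onto (§10.5; `𝔪_y` is then maximal); `map_ker_eq_of_ker_comp_eq`:
  the converse when `φ` is onto. So for [FF18]'s automorphism `φ` the two typings of §10.13 agree.
* §2 `nonempty_transport_of_map_ker_eq`: «`φ` an ONTO ring endomorphism of `B` restricting to the signature's `ϕ_B`» + «`η_y`,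
  `η_{ϕ(y)}` onto» + literal §10.13 at `y` ⇒ `Nonempty (FrobeniusTransport D y)`; `…_of_ringEquiv`: the automorphism case.
* §3 Consequences at such a point, by the lineage's lemmas: NO (R-fix) horn (`not_logsCoincide_of_map_ker_eq`), Thm. 10.15.1
  (3) FAILS in both typed forms (`not_noInsertedIso_of_map_ker_eq`, `not_noCommutingFieldIso_of_map_ker_eq`).
* §4 THE LOCATED SENTENCE (contrapositive, `map_ker_ne_of_logsCoincide`): an (R-fix) horn at `y` — `LogsCoincide I`, the
  logarithm of `ϕ(y)` hitting `1`, `p ≠ 1` in `C`: the hypotheses under which print's `τ(1) = p` proof of (3) goes through —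
  forces `φ(𝔪_y) ≠ 𝔪_{ϕ(y)}` for EVERY onto ring endomorphism `φ` of `B` restricting to `ϕ_B`, once `η_y`, `η_{ϕ(y)}` are onto.
  In words: the (R-fix) horn needs a point where ϕ on `|Y|` is NOT induced by the Frobenius of `B`, whereas print obtains
  `ϕ(y)` through `𝔪_{ϕ(y)} = φ(𝔪_y)` (p.33 l.7–10). Over any structure recording «`φ` onto `B`, `η` onto, §10.13 literal at every
  point» the (R-fix) horn is therefore EMPTY (`no_rfix_horn_of_induced`), and (3) fails everywhere in both typed forms.
* §5 INSTANCE at p439129's horn point `c_0` (decls of `ConfluentModel` used BY NAME): literal §10.13 fails at `c_0` for every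
  onto `φ` restricting to the model's Frobenius (`ConfluentModel.Induced.map_ker_ne_zero`), and — the separating datum of
  `both_horns_one_structure` named in kernel — the model's Frobenius `b ↦ b ∘ σ′` is NEITHER injective (`c_0 ∉ image σ′`:
  `frob (ind0) = 0`) NOR surjective (`σ′(c_0) = σ′(c_1)`: every `φ(b)` takes equal values at `c_0`, `c_1`), whereas [FF18]'s `φ`
  is bijective.
* §6 NON-VACUITY of §2–§4's hypotheses at every column point of E-t52's two-sided column model p434703 (`ColumnModel`, BY
  NAME): there `σ` is injective, so `φ = (· ∘ σ)` is ONTO, §10.13 holds literally (`map_ker_eq_col`), `η` onto, log hits `1`,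
  `p ≠ 1` — and only the (R-ϕ) horn occurs (`induced_hypotheses_nonvacuous`).
Continuity remains unmodelled (no topology in the signature; p430819/p436476/p437232 docstrings): the typed (3) quantifies over
all ring isomorphisms. [folklore] algebra throughout; no claim about Joshi's or Mochizuki's mathematics is made or implied.
-/

noncomputable section

open Function

namespace Summit.ABC.IUTFork.Joshi

namespace PeriodRingDatum

variable {F B E0 : Type} [Field F] [CommRing B] [Field E0] {Y : Type} {K : Y → Type} [∀ y, Field (K y)] {G : Type}
  {D : PeriodRingDatum F B E0 Y K G}

/-! ## 1. §10.13 read literally (`φ(𝔪_y) = 𝔪_{ϕ(y)}`) versus p430819's kernel form (`φ⁻¹(𝔪_{ϕ(y)}) = 𝔪_y`) -/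

/-- **Literal §10.13 ⇒ kernel form.** If `η_y : B → K_y` is onto (§10.5 p.31 l.40–45), so that `𝔪_y = ker η_y` is maximal, and a
ring endomorphism `φ` of `B` satisfies `φ(𝔪_y) = 𝔪_{ϕ(y)}` as ideals (p.33 l.1–12, `Ideal.map`), then `ker (η_{ϕ(y)} ∘ φ) = ker η_y`
— the field `ker_eq` of p430819's `FrobeniusTransport`. (`𝔪_y ≤ φ⁻¹(φ(𝔪_y)) = φ⁻¹(𝔪_{ϕ(y)}) ≠ B`, and `𝔪_y` is maximal.) No
injectivity or surjectivity of `φ` is used. [folklore] -/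
theorem ker_comp_eq_of_map_ker_eq {y : Y} (φ : B →+* B) (hη : Surjective (D.eta y))
    (hmap : Ideal.map φ (RingHom.ker (D.eta y)) = RingHom.ker (D.eta (D.frobY y))) :
    RingHom.ker ((D.eta (D.frobY y)).comp φ) = RingHom.ker (D.eta y) := by
  have hmax : (RingHom.ker (D.eta y)).IsMaximal := RingHom.ker_isMaximal_of_surjective (D.eta y) hη
  refine (hmax.eq_of_le (RingHom.ker_ne_top _) ?_).symm
  rw [← RingHom.comap_ker, ← hmap]
  exact Ideal.le_comap_map

/-- **Kernel form ⇒ literal §10.13, when `φ` is onto** (`φ(φ⁻¹(𝔪_{ϕ(y)})) = 𝔪_{ϕ(y)}`). For [FF18]'s automorphism `φ` the two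
typings of §10.13 therefore AGREE. [folklore] -/
theorem map_ker_eq_of_ker_comp_eq {y : Y} (φ : B →+* B) (hφ : Surjective φ)
    (hker : RingHom.ker ((D.eta (D.frobY y)).comp φ) = RingHom.ker (D.eta y)) :
    Ideal.map φ (RingHom.ker (D.eta y)) = RingHom.ker (D.eta (D.frobY y)) := by
  rw [← hker, ← RingHom.comap_ker, Ideal.map_comap_of_surjective φ hφ]

/-- In particular the `ker_eq` field of any §10.13 transport whose `frobHom` is onto IS the literal sentence
`φ(𝔪_y) = 𝔪_{ϕ(y)}`. [folklore] -/
theorem FrobeniusTransport.map_ker_eq {y : Y} (T : D.FrobeniusTransport y) (hφ : Surjective T.frobHom) :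
    Ideal.map T.frobHom (RingHom.ker (D.eta y)) = RingHom.ker (D.eta (D.frobY y)) :=
  map_ker_eq_of_ker_comp_eq T.frobHom hφ T.ker_eq

/-! ## 2. Where ϕ on `|Y|` is induced by an onto Frobenius of `B`, the transport EXISTS -/

/-- **[FF18]'s standing structure supplies §10.13's transport.** If `φ` is an ONTO ring endomorphism of `B` restricting to the
signature's Frobenius `ϕ_B` (in [FF18] `φ` is even an automorphism, `F` perfect), `η_y` and `η_{ϕ(y)}` are onto (§10.5), and
§10.13 holds literally at `y` (`φ(𝔪_y) = 𝔪_{ϕ(y)}`), then p430819's HYPOTHESIS structure `FrobeniusTransport D y` is INHABITED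
(witness: `frobHom := φ`; `η_{ϕ(y)} ∘ φ` is onto as a composite of onto maps; `ker_eq` by §1). [folklore] -/
theorem nonempty_transport_of_map_ker_eq {y : Y} (φ : B →+* B) (hφD : ∀ b : B, φ b = D.frob b) (hφ : Surjective φ)
    (hη : Surjective (D.eta y)) (hη' : Surjective (D.eta (D.frobY y)))
    (hmap : Ideal.map φ (RingHom.ker (D.eta y)) = RingHom.ker (D.eta (D.frobY y))) :
    Nonempty (D.FrobeniusTransport y) :=
  ⟨{ frobHom := φ
     frobHom_eq := hφD
     eta_surj := hη
     eta_frob_surj := hη'.comp hφ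
     ker_eq := ker_comp_eq_of_map_ker_eq φ hη hmap }⟩

/-- The automorphism case («`φ` is a ring automorphism of `B`», [FF18]): literal §10.13 at `y` + `η` onto at both ends ⇒ transport.
[folklore] -/
theorem nonempty_transport_of_ringEquiv {y : Y} (φ : B ≃+* B) (hφD : ∀ b : B, φ b = D.frob b)
    (hη : Surjective (D.eta y)) (hη' : Surjective (D.eta (D.frobY y)))
    (hmap : Ideal.map (φ : B →+* B) (RingHom.ker (D.eta y)) = RingHom.ker (D.eta (D.frobY y))) :
    Nonempty (D.FrobeniusTransport y) :=
  nonempty_transport_of_map_ker_eq (φ : B →+* B) hφD φ.surjective hη hη' hmap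

/-! ## 3. Consequences at an induced point (the lineage's lemmas, now unconditional in the transport) -/

section Induced

variable {y : Y} (φ : B →+* B) (hφD : ∀ b : B, φ b = D.frob b) (hφ : Surjective φ) (hη : Surjective (D.eta y))
  (hη' : Surjective (D.eta (D.frobY y))) (hmap : Ideal.map φ (RingHom.ker (D.eta y)) = RingHom.ker (D.eta (D.frobY y)))
  {C : Type} [Field C]
include hφD hφ hη hη' hmap

/-- **No (R-fix) horn at an induced point**: for EVERY common target `I` (both residue fields identified with one field `C`),
once the logarithm of `ϕ(y)` hits `1` and `p ≠ 1` in `C`, the two logarithms do NOT coincide (p436476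
`not_logsCoincide_of_transport`, the transport now supplied by §2). [claim: Joshi2023ATS2Local, status: disputed] -/
theorem not_logsCoincide_of_map_ker_eq (I : D.CommonTarget C y) (hone : ∃ b ∈ D.Bphi, D.eta (D.frobY y) b = 1)
    (hp : (D.p : C) ≠ 1) : ¬ LogsCoincide I := by
  obtain ⟨T⟩ := nonempty_transport_of_map_ker_eq φ hφD hφ hη hη' hmap
  exact not_logsCoincide_of_transport T I hone hp

/-- **Thm. 10.15.1 (3), common-target form, FAILS at an induced point for every identification with `C`** (p436476
`not_noInsertedIso_of_transport`). [claim: Joshi2023ATS2Local, status: disputed] -/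
theorem not_noInsertedIso_of_map_ker_eq (I : D.CommonTarget C y) : ¬ NoInsertedIso I := by
  obtain ⟨T⟩ := nonempty_transport_of_map_ker_eq φ hφD hφ hη hη' hmap
  exact not_noInsertedIso_of_transport T I

omit [Field C] in
/-- **Thm. 10.15.1 (3), E-t3's as-printed middle-row form `NoCommutingFieldIso y`, FAILS at an induced point** (p430819
`not_noCommutingFieldIso_of_transport`). [claim: Joshi2023ATS2Local, status: disputed] -/
theorem not_noCommutingFieldIso_of_map_ker_eq : ¬ D.NoCommutingFieldIso y := by
  obtain ⟨T⟩ := nonempty_transport_of_map_ker_eq φ hφD hφ hη hη' hmap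
  exact D.not_noCommutingFieldIso_of_transport T

end Induced

/-! ## 4. The located sentence: an (R-fix) horn needs a point where ϕ on `|Y|` is NOT induced by the Frobenius of `B` -/

/-- **LOCATED SENTENCE (kernel; no side taken).** At a point `y` carrying the (R-fix) horn — the logarithms coincide for some
common target `I`, the logarithm of `ϕ(y)` hits `1`, `p ≠ 1` in `C`: exactly the hypotheses of print's `τ(1) = p` proof of
Thm. 10.15.1 (3) as typed by p430819 `noInsertedIso_of_logsCoincide` — §10.13 read literally FAILS for EVERY onto ring
endomorphism `φ` of `B` restricting to `ϕ_B`, as soon as `η_y` and `η_{ϕ(y)}` are onto: `φ(𝔪_y) ≠ 𝔪_{ϕ(y)}` — whereas print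
obtains the point `ϕ(y)` through `𝔪_{ϕ(y)} = φ(𝔪_y)` (p.33 l.7–10, with [FF18]'s automorphism `φ` and §10.5's onto `η`). Located,
not adjudicated. [claim: Joshi2023ATS2Local, status: disputed] -/
theorem map_ker_ne_of_logsCoincide {y : Y} {C : Type} [Field C] (I : D.CommonTarget C y) (hfix : LogsCoincide I)
    (hone : ∃ b ∈ D.Bphi, D.eta (D.frobY y) b = 1) (hp : (D.p : C) ≠ 1) (φ : B →+* B)
    (hφD : ∀ b : B, φ b = D.frob b) (hφ : Surjective φ) (hη : Surjective (D.eta y))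
    (hη' : Surjective (D.eta (D.frobY y))) :
    Ideal.map φ (RingHom.ker (D.eta y)) ≠ RingHom.ker (D.eta (D.frobY y)) :=
  fun hmap => not_logsCoincide_of_map_ker_eq φ hφD hφ hη hη' hmap I hone hp hfix

/-- The same with the kernel form: at an (R-fix) horn point, `φ⁻¹(𝔪_{ϕ(y)}) ≠ 𝔪_y` for every ring endomorphism `φ` restricting to
`ϕ_B` with `η_y` and `η_{ϕ(y)} ∘ φ` onto (no surjectivity of `φ` itself assumed) — p436476's emptiness of the transport, field by
field. [claim: Joshi2023ATS2Local, status: disputed] -/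
theorem ker_comp_ne_of_logsCoincide {y : Y} {C : Type} [Field C] (I : D.CommonTarget C y) (hfix : LogsCoincide I)
    (hone : ∃ b ∈ D.Bphi, D.eta (D.frobY y) b = 1) (hp : (D.p : C) ≠ 1) (φ : B →+* B)
    (hφD : ∀ b : B, φ b = D.frob b) (hη : Surjective (D.eta y)) (hηφ : Surjective ((D.eta (D.frobY y)).comp φ)) :
    RingHom.ker ((D.eta (D.frobY y)).comp φ) ≠ RingHom.ker (D.eta y) :=
  fun hker => logsCoincide_absurd_of_transport
    { frobHom := φ, frobHom_eq := hφD, eta_surj := hη, eta_frob_surj := hηφ, ker_eq := hker } I hfix hone hp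

/-- **Over a structure recording [FF18]'s three standing properties the (R-fix) horn is EMPTY.** If `φ` is an onto ring
endomorphism of `B` restricting to `ϕ_B`, every `η_y` is onto, and §10.13 holds literally at EVERY point, then at NO point and
for NO common target do «logarithms coincide ∧ log of `ϕ(y)` hits `1` ∧ `p ≠ 1`» hold together — the reading under which
print's proof of Thm. 10.15.1 (3) goes through has no realisation there, and (3) fails everywhere in both typed forms (§3).
What this does NOT say: anything about continuity (unmodelled), or about which reading print intends. [claim: Joshi2023ATS2Local, status: disputed] -/
theorem no_rfix_horn_of_induced (φ : B →+* B) (hφD : ∀ b : B, φ b = D.frob b) (hφ : Surjective φ)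
    (hη : ∀ y : Y, Surjective (D.eta y))
    (hmap : ∀ y : Y, Ideal.map φ (RingHom.ker (D.eta y)) = RingHom.ker (D.eta (D.frobY y)))
    {C : Type} [Field C] (y : Y) (I : D.CommonTarget C y) :
    ¬ (LogsCoincide I ∧ (∃ b ∈ D.Bphi, D.eta (D.frobY y) b = 1) ∧ (D.p : C) ≠ 1) :=
  fun h => not_logsCoincide_of_map_ker_eq φ hφD hφ (hη y) (hη (D.frobY y)) (hmap y) I h.2.1 h.2.2 h.1

/-- … and under the same standing properties §10.13's transport exists at EVERY point (so p434703's (R-ϕ) horn is the only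
horn such a structure can carry). [folklore] -/
theorem nonempty_transport_everywhere_of_induced (φ : B →+* B) (hφD : ∀ b : B, φ b = D.frob b) (hφ : Surjective φ)
    (hη : ∀ y : Y, Surjective (D.eta y))
    (hmap : ∀ y : Y, Ideal.map φ (RingHom.ker (D.eta y)) = RingHom.ker (D.eta (D.frobY y))) (y : Y) :
    Nonempty (D.FrobeniusTransport y) :=
  nonempty_transport_of_map_ker_eq φ hφD hφ (hη y) (hη (D.frobY y)) (hmap y)

end PeriodRingDatum

/-! ## 5. Instance: p439129's horn point `c_0` — literal §10.13 fails there, and the model's Frobenius is not bijective -/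

namespace ConfluentModel.Induced

open ColumnModel ConfluentModel

variable (p : ℕ) [hp : Fact p.Prime]

/-- **Literal §10.13 FAILS at the (R-fix) horn point `y₀ = c_0` of the confluent column model** for every onto ring
endomorphism `φ` of `B = (Q̄_p → Q̄_p)` restricting to the model's `ϕ_B = (· ∘ σ′)` (§4 at E-t52's `logsCoincide_zero`, `hone`,
`modelP_ne_one`; evaluations are onto). As §5's last two theorems show, there is in fact NO such `φ` — the hypothesis is met
vacuously here; the non-vacuous content is `ker_comp_ne_zero` below. [folklore] -/
theorem map_ker_ne_zero (φ : (PadicAlgCl p → PadicAlgCl p) →+* (PadicAlgCl p → PadicAlgCl p))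
    (hφD : ∀ b, φ b = (confluentDatum p).frob b) (hφ : Surjective φ) :
    Ideal.map φ (RingHom.ker ((confluentDatum p).eta (col p 0))) ≠
      RingHom.ker ((confluentDatum p).eta ((confluentDatum p).frobY (col p 0))) :=
  PeriodRingDatum.map_ker_ne_of_logsCoincide (idTarget p (col p 0)) (logsCoincide_zero p) (hone p 0) (modelP_ne_one p) φ
    hφD hφ (fun k => ⟨fun _ => k, rfl⟩) (fun k => ⟨fun _ => k, rfl⟩)

/-- **The kernel form of §10.13 FAILS at `c_0` for the model's own Frobenius ring map** `φ = (· ∘ σ′)` (a ring endomorphism of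
the function ring; `η_{c_1} ∘ φ = ` evaluation at `σ′(c_1) = c_{−1}` is onto): `φ⁻¹(𝔪_{c_1}) = 𝔪_{c_{−1}} ≠ 𝔪_{c_0}` — E-t52's
`exists_ker_witness` / `no_transport_zero`, re-obtained from the horn through §4. [folklore] -/
theorem ker_comp_ne_zero :
    RingHom.ker (((confluentDatum p).eta ((confluentDatum p).frobY (col p 0))).comp
        (RingHom.pi fun s => Pi.evalRingHom (fun _ : PadicAlgCl p => PadicAlgCl p) (cshift p s))) ≠
      RingHom.ker ((confluentDatum p).eta (col p 0)) :=
  PeriodRingDatum.ker_comp_ne_of_logsCoincide (idTarget p (col p 0)) (logsCoincide_zero p) (hone p 0) (modelP_ne_one p) _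
    (fun _ => rfl) (fun k => ⟨fun _ => k, rfl⟩) (fun k => ⟨fun _ => k, rfl⟩)

/-- `σ′` never takes the value `c_0` (`σ′(c_1) = c_{−1}`, `σ′(c_n) = c_{n−1} ≠ c_0` for `n ≠ 1`, `σ′ = id` off the column):
`c_0 ∉ image σ′`. [folklore] -/
theorem cshift_ne_col_zero (s : PadicAlgCl p) : cshift p s ≠ col p 0 := by
  by_cases hcol : ∃ n : ℤ, col p n = s
  · obtain ⟨n, rfl⟩ := hcol
    by_cases hn : n = 1
    · subst hn; rw [cshift_col_one]; exact fun h => absurd (col_injective p h) (by decide)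
    · rw [cshift_col p hn]; exact fun h => hn (by have := col_injective p h; omega)
  · simp only [not_exists] at hcol
    rw [cshift_of_not_col p hcol]; exact fun h => hcol 0 h.symm

/-- **`ϕ_B(ind0) = 0`**: the indicator of `c_0` composed with `σ′` vanishes identically (`c_0 ∉ image σ′`). [folklore] -/
theorem frob_ind0 : (confluentDatum p).frob (ind0 p) = 0 := by
  rw [frob_def]; funext s
  show ind0 p (cshift p s) = 0
  unfold ind0; rw [if_neg (cshift_ne_col_zero p s)]

/-- `ind0 ≠ 0` (`ind0 (c_0) = 1`). [folklore] -/
theorem ind0_ne_zero : ind0 p ≠ 0 := fun h => by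
  have h1 := congrFun h (col p 0); rw [ind0_col_zero] at h1; exact one_ne_zero h1

/-- **The confluent model's Frobenius on `B` is NOT INJECTIVE** (`ϕ_B(ind0) = 0 = ϕ_B(0)`, `ind0 ≠ 0`) — unlike [FF18]'s `φ`,
a ring automorphism of `B`. This is the datum by which p439129 separates the two horns. [folklore] -/
theorem frob_not_injective : ¬ Injective (confluentDatum p).frob := fun hinj =>
  ind0_ne_zero p (hinj ((frob_ind0 p).trans (by rw [frob_def]; rfl)))

/-- **… and NOT SURJECTIVE**: every `ϕ_B(b) = b ∘ σ′` takes the same value at `c_0` and `c_1` (`σ′(c_0) = σ′(c_1) = c_{−1}`),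
while `ind0 (c_0) = 1 ≠ 0 = ind0 (c_1)`. So §2's hypothesis «`φ` onto, restricting to `ϕ_B`» has NO witness in this model —
consistent with §4: the model's (R-fix) horn lives off [FF18]'s standing structure. [folklore] -/
theorem frob_not_surjective : ¬ Surjective (confluentDatum p).frob := fun hsurj => by
  obtain ⟨b, hb⟩ := hsurj (ind0 p)
  have h0 := congrFun hb (col p 0)
  have h1 := congrFun hb (col p 1)
  rw [frob_def, Function.comp_apply, cshift_col_zero] at h0
  rw [frob_def, Function.comp_apply, cshift_col_one] at h1
  rw [ind0_col_zero] at h0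
  have h1' : ind0 p (col p 1) = 0 := by
    unfold ind0; rw [if_neg (fun h => absurd (col_injective p h) (by decide))]
  rw [h1'] at h1
  exact one_ne_zero (h0.symm.trans h1)

/-- Packaging for the §M sentence: in p439129's ONE structure with both horns, the (R-fix) horn point `c_0` has no §10.13
transport (E-t52), the model's `ϕ_B` is neither injective nor surjective (this file), and §2's inducing hypothesis is
unsatisfiable there — while wherever an onto `φ` induces ϕ (§2–§4) only the (R-ϕ) horn can occur. [folklore] -/
theorem separating_datum :
    IsEmpty ((confluentDatum p).FrobeniusTransport (col p 0)) ∧ ¬ Injective (confluentDatum p).frob ∧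
      ¬ Surjective (confluentDatum p).frob ∧
      ¬ ∃ φ : (PadicAlgCl p → PadicAlgCl p) →+* (PadicAlgCl p → PadicAlgCl p),
          (∀ b, φ b = (confluentDatum p).frob b) ∧ Surjective φ :=
  ⟨no_transport_zero p, frob_not_injective p, frob_not_surjective p,
    fun ⟨φ, hφD, hφ⟩ => frob_not_surjective p (fun b => by obtain ⟨a, ha⟩ := hφ b; exact ⟨a, (hφD a) ▸ ha⟩)⟩

end ConfluentModel.Induced

/-! ## 6. Non-vacuity of §2's hypotheses: p434703's two-sided column model (there only the (R-ϕ) horn occurs) -/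

namespace ColumnModel.Induced

open ColumnModel

variable (p : ℕ) [hp : Fact p.Prime]

/-- p434703's shift `σ` (`σ(c_n) = c_{n−1}`, identity off the column) is INJECTIVE. [folklore] -/
theorem shift_injective : Injective (shift p) := by
  intro a b h
  by_cases ha : ∃ n : ℤ, col p n = a <;> by_cases hb : ∃ m : ℤ, col p m = b
  · obtain ⟨n, rfl⟩ := ha; obtain ⟨m, rfl⟩ := hb
    rw [shift_col, shift_col] at h
    have hnm := col_injective p h
    rw [show n = m by omega]
  · obtain ⟨n, rfl⟩ := ha
    simp only [not_exists] at hb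
    rw [shift_col, shift_of_not_col p hb] at h
    exact absurd h (hb (n - 1))
  · obtain ⟨m, rfl⟩ := hb
    simp only [not_exists] at ha
    rw [shift_of_not_col p ha, shift_col] at h
    exact absurd h.symm (ha (m - 1))
  · simp only [not_exists] at ha hb
    rwa [shift_of_not_col p ha, shift_of_not_col p hb] at h

/-- Hence the column model's Frobenius ring map `φ = (· ∘ σ)` (p434703 `ColumnModel.transport`, field `frobHom`) is ONTO — as
[FF18]'s `φ` is. [folklore] -/
theorem frobHom_surjective (n : ℤ) : Surjective (transport p n).frobHom := fun b => by
  obtain ⟨a, ha⟩ := (shift_injective p).surjective_comp_right (γ := PadicAlgCl p) b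
  exact ⟨a, by rw [(transport p n).frobHom_eq, frob_def]; exact ha⟩

/-- **Literal §10.13 HOLDS at every column point `c_n` of p434703's model**: `φ(𝔪_{c_n}) = 𝔪_{ϕ(c_n)}` (§1 applied to
p434703's transport, `φ` onto). [folklore] -/
theorem map_ker_eq_col (n : ℤ) :
    Ideal.map (transport p n).frobHom (RingHom.ker ((columnDatum p).eta (col p n))) =
      RingHom.ker ((columnDatum p).eta ((columnDatum p).frobY (col p n))) :=
  (transport p n).map_ker_eq (frobHom_surjective p n)

/-- **NON-VACUITY of §2–§4's hypotheses** (refuters' vacuity smell): at every column point `c_n` of p434703's model of the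
whole signature (with `KummerShift`, `B^{φ=p} ≠ 0`) there IS an onto ring endomorphism `φ` of `B` restricting to `ϕ_B` with
§10.13 literal at `c_n`, both `η`'s are onto, the logarithm hits `1`, `p ≠ 1` — and accordingly (§3) the logarithms do NOT
coincide there: only the (R-ϕ) horn occurs (p434703 `rphi_horn_nonvacuous`, `not_logsCoincide`, re-obtained through §3).
[folklore] -/
theorem induced_hypotheses_nonvacuous (n : ℤ) :
    (∃ φ : (PadicAlgCl p → PadicAlgCl p) →+* (PadicAlgCl p → PadicAlgCl p),
        (∀ b, φ b = (columnDatum p).frob b) ∧ Surjective φ ∧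
          Ideal.map φ (RingHom.ker ((columnDatum p).eta (col p n))) =
            RingHom.ker ((columnDatum p).eta ((columnDatum p).frobY (col p n)))) ∧
      Surjective ((columnDatum p).eta (col p n)) ∧
      Surjective ((columnDatum p).eta ((columnDatum p).frobY (col p n))) ∧
      (∃ b ∈ (columnDatum p).Bphi, (columnDatum p).eta ((columnDatum p).frobY (col p n)) b = 1) ∧
      ((columnDatum p).p : PadicAlgCl p) ≠ 1 ∧
      ¬ PeriodRingDatum.LogsCoincide (target p n) :=
  ⟨⟨(transport p n).frobHom, (transport p n).frobHom_eq, frobHom_surjective p n, map_ker_eq_col p n⟩,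
    (transport p n).eta_surj, fun k => ⟨fun _ => k, rfl⟩, hone p n, modelP_ne_one p,
    PeriodRingDatum.not_logsCoincide_of_map_ker_eq _ (transport p n).frobHom_eq (frobHom_surjective p n)
      (transport p n).eta_surj (fun k => ⟨fun _ => k, rfl⟩) (map_ker_eq_col p n) (target p n) (hone p n)
      (modelP_ne_one p)⟩

end ColumnModel.Induced

end Summit.ABC.IUTFork.Joshi

end
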